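import Summits.Ventures.PackingBounds.Configurations.CL17Count

/-!
# Cohn–Li in dimension `17`, IV: pairwise inner products `≤ 36`

Framing: lottery ticket; floor = certified bounds/negative ranges. Venture `PackingBounds` (cell
`pub-packcert`, seat `pub-packcert-energy`).

The fifteen shape pairs of the integer model `cl17Int` (`CL17Count.lean`), all through the master formula of
`CL17Vectors.lean` (`ip = a a' (|S ∩ S'| − 2 D) + 2 e e'`): shape `A` against anything by the size of the
entries; `B·B`, `B·X`, `X·X` by the intersections of supports (`≤ 4`, `≤ 4`, `≤ 2` cells, kernel facts of
`CL17Codes.lean`) or, on a common support, by the two odd patterns differing in `≥ 2` places; `B·D` and `X·D` by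
Cohn–Li's parity argument (`C₁₀ ⊥ C₆`: an odd pattern and an even one differ somewhere); `D·D` by the distances
`≥ 6` inside `C⁺`, `C⁻` and `≥ 4` across (with opposite axis signs). Result: `ip x y ≤ 36` for `x ≠ y`
(`ip_le_of_mem`), i.e. angles `≥ 60°` after normalisation (`CL17.lean`).

## References
* H. Cohn, A. Li, *Improved kissing numbers in seventeen through twenty-one dimensions*, arXiv:2411.04916 (2024), §3. [`CohnLi2024`]
-/

namespace Summit.Ventures.PackingBounds.Config.CL17

open Finset Leech Golay

/-- Entries on the cells are bounded by `|a|`: `3` for shapes `B, X`, `2` for `D`, `0` for `T`. -/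
theorem abs_apply_le_of_mem {x : Fin 24 → ℤ} :
    (x ∈ setB → ∀ j : Fin 24, j.val < 16 → |x j| ≤ 3) ∧ (x ∈ setX → ∀ j : Fin 24, j.val < 16 → |x j| ≤ 3) ∧
    (x ∈ setT → ∀ j : Fin 24, j.val < 16 → |x j| ≤ 0) ∧ (x ∈ setD → ∀ j : Fin 24, j.val < 16 → |x j| ≤ 2) := by
  refine ⟨fun hx j hj => ?_, fun hx j hj => ?_, fun hx j hj => ?_, fun hx j hj => ?_⟩
  · obtain ⟨i, v, _, rfl⟩ := mem_setB.mp hx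
    exact (abs_pvec_apply_le _ _ _ hj).trans (by norm_num)
  · obtain ⟨i, v, _, c, rfl⟩ := mem_setX.mp hx
    exact (abs_pvec_apply_le _ _ _ hj).trans (by norm_num)
  · obtain ⟨c, rfl⟩ := mem_setT.mp hx
    exact (abs_pvec_apply_le _ _ _ hj).trans (by norm_num)
  · obtain ⟨p, _, m, _, rfl⟩ := mem_setD.mp hx
    exact (abs_pvec_apply_le _ _ _ hj).trans (by norm_num)

/-! ### Pairwise inner products, shape by shape -/

/-- Shape `A` against a vector with cell entries of absolute value `≤ b`: `ip ≤ 12 b`. -/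
theorem ip_setA_le {x y : Fin 24 → ℤ} (hx : x ∈ setA) {b : ℤ} (hy : ∀ j : Fin 24, j.val < 16 → |y j| ≤ b) :
    ip x y ≤ 12 * b := by
  obtain ⟨k, l, a, c, ⟨hkl, hl⟩, rfl⟩ := mem_setA.mp hx
  have hk : k.val < 16 := lt_trans hkl hl
  rw [ip_comm, aV]
  have h := ip_pvec_pair_le hk hl (ne_of_lt hkl) (fun j => if j = k then a else c) 6 (hy k hk) (hy l hl)
  have h6 : (2 : ℤ) * |6| * b = 12 * b := by norm_num
  linarith

/-- `A · A ≤ 36` for distinct vectors. -/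
theorem ip_AA {x y : Fin 24 → ℤ} (hx : x ∈ setA) (hy : y ∈ setA) (hne : x ≠ y) : ip x y ≤ 36 := by
  obtain ⟨k, l, a, b, ⟨hkl, hl⟩, rfl⟩ := mem_setA.mp hx
  obtain ⟨k', l', a', b', ⟨hkl', hl'⟩, rfl⟩ := mem_setA.mp hy
  have hk : k.val < 16 := lt_trans hkl hl
  have hk' : k'.val < 16 := lt_trans hkl' hl'
  unfold aV at hne ⊢
  by_cases hS : ({k, l} : Finset (Fin 24)) = {k', l'}
  · rw [← hS] at hne ⊢
    have hne' : ∃ j ∈ ({k, l} : Finset (Fin 24)),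
        (fun j => if j = k then a else b) j ≠ (fun j => if j = k' then a' else b') j := by
      by_contra hall
      push Not at hall
      exact hne (pvec_congr hall 6 0)
    rw [ip_pvec_pvec (pair_sub hk hl) (pair_sub hk hl), Finset.inter_self, card_pair (ne_of_lt hkl)]
    obtain ⟨j, hj, hfj⟩ := hne'
    have hpos : 0 < (({k, l} : Finset (Fin 24)).filter fun j =>
        ((fun j => if j = k then a else b) j ^^ (fun j => if j = k' then a' else b') j) = true).card := by
      apply Finset.card_pos.mpr
      refine ⟨j, Finset.mem_filter.mpr ⟨hj, ?_⟩⟩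
      revert hfj
      cases (fun j => if j = k then a else b) j <;> cases (fun j => if j = k' then a' else b') j <;> simp
    push_cast
    nlinarith
  · have hcard : (({k, l} : Finset (Fin 24)) ∩ {k', l'}).card ≤ 1 := by
      by_contra hlt
      push Not at hlt
      have h2 : ({k, l} : Finset (Fin 24)).card = 2 := card_pair (ne_of_lt hkl)
      have h2' : ({k', l'} : Finset (Fin 24)).card = 2 := card_pair (ne_of_lt hkl')
      have hsub : ({k, l} : Finset (Fin 24)) ∩ {k', l'} = {k, l} :=
        Finset.eq_of_subset_of_card_le Finset.inter_subset_left (by omega)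
      have hss : ({k, l} : Finset (Fin 24)) ⊆ {k', l'} := by rw [← hsub]; exact Finset.inter_subset_right
      exact hS (Finset.eq_of_subset_of_card_le hss (by omega))
    have h := ip_pvec_pvec_le_inter (pair_sub hk hl) (pair_sub hk' hl') (fun j => if j = k then a else b)
      (fun j => if j = k' then a' else b') (by norm_num : (0 : ℤ) ≤ 6 * 6) 0 0
    have hc : ((({k, l} : Finset (Fin 24)) ∩ {k', l'}).card : ℤ) ≤ 1 := by exact_mod_cast hcard
    linarith

/-- `B · B ≤ 36` for distinct vectors (same word: odd patterns differ twice; distinct words: `≤ 4` common cells). -/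
theorem ip_BB {x y : Fin 24 → ℤ} (hx : x ∈ setB) (hy : y ∈ setB) (hne : x ≠ y) : ip x y ≤ 36 := by
  obtain ⟨i, v, hv, rfl⟩ := mem_setB.mp hx
  obtain ⟨i', v', hv', rfl⟩ := mem_setB.mp hy
  by_cases hii : i = i'
  · subst hii
    have hvv : v ≠ v' := fun h => hne (by rw [h])
    have hne' : ∃ j ∈ supp (w8 i), pat8 i v j ≠ pat8 i v' j := by
      by_contra hall
      push Not at hall
      exact hvv (pat8_inj hv hv' hall)
    have h := ip_pvec_pvec_le_of_odd_odd (supp_w8_sub i) (odd_card_pat8 i v) (odd_card_pat8 i v') hne'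
      (by norm_num : (0 : ℤ) ≤ 3 * 3) 0 0
    rw [card_supp_w8] at h
    push_cast at h
    linarith
  · have h4 := card_w8_inter_w8 i.isLt i'.isLt (fun h => hii (Fin.ext h))
    have h := ip_pvec_pvec_le_inter (supp_w8_sub i) (supp_w8_sub i') (pat8 i v) (pat8 i' v')
      (by norm_num : (0 : ℤ) ≤ 3 * 3) 0 0
    have h4' : ((supp (w8 i) ∩ supp (w8 i')).card : ℤ) ≤ 4 := by exact_mod_cast h4
    linarith

/-- `B · X ≤ 36` (`≤ 4` common cells). -/
theorem ip_BX {x y : Fin 24 → ℤ} (hx : x ∈ setB) (hy : y ∈ setX) : ip x y ≤ 36 := by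
  obtain ⟨i, v, _, rfl⟩ := mem_setB.mp hx
  obtain ⟨i', v', _, c, rfl⟩ := mem_setX.mp hy
  have h4 := card_w8_inter_x6 (i := i.val) (i' := i'.val) i.isLt i'.isLt
  have h := ip_pvec_pvec_le_inter (supp_w8_sub i) (supp_x6_sub i') (pat8 i v) (pat6 i' v')
    (by norm_num : (0 : ℤ) ≤ 3 * 3) 0 (3 * sgn c)
  have h4' : ((supp (w8 i) ∩ supp (x6 i')).card : ℤ) ≤ 4 := by exact_mod_cast h4
  linarith

/-- `B · T = 0 ≤ 36`. -/
theorem ip_BT {x y : Fin 24 → ℤ} (hx : x ∈ setB) (hy : y ∈ setT) : ip x y ≤ 36 := by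
  obtain ⟨i, v, _, rfl⟩ := mem_setB.mp hx
  obtain ⟨c, rfl⟩ := mem_setT.mp hy
  have h := ip_pvec_pvec_le_inter (supp_w8_sub i) (Finset.empty_subset _) (pat8 i v) (fun _ => false)
    (by norm_num : (0 : ℤ) ≤ 3 * 0) 0 (6 * sgn c)
  rw [Finset.inter_empty, Finset.card_empty] at h
  push_cast at h
  linarith

/-- **`B · D ≤ 36`**: the word of `C⁺ ∪ C⁻` meets the pair/square evenly, the pattern is odd, so at least one
sign disagrees (Cohn–Li's parity argument). -/
theorem ip_BD {x y : Fin 24 → ℤ} (hx : x ∈ setB) (hy : y ∈ setD) : ip x y ≤ 36 := by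
  obtain ⟨i, v, _, rfl⟩ := mem_setB.mp hx
  obtain ⟨p, hp, m, _, rfl⟩ := mem_setD.mp hy
  have hev : Even ((supp (w8 i)).filter fun j : Fin 24 => (cd p m).testBit j.val = true).card := by
    rw [card_filter_testBit]; exact even_card_w8_inter_cd i.isLt hp m
  have h := ip_pvec_pvec_le_of_odd_even (supp_w8_sub i) subset_rfl (odd_card_pat8 i v) hev
    (by norm_num : (0 : ℤ) ≤ 3 * 2) 0 (2 * sgn (decide (6 ≤ p)))
  rw [card_supp_w8] at h
  push_cast at h
  linarith

/-- `X · X ≤ 36` for distinct vectors. -/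
theorem ip_XX {x y : Fin 24 → ℤ} (hx : x ∈ setX) (hy : y ∈ setX) (hne : x ≠ y) : ip x y ≤ 36 := by
  obtain ⟨i, v, hv, c, rfl⟩ := mem_setX.mp hx
  obtain ⟨i', v', hv', c', rfl⟩ := mem_setX.mp hy
  by_cases hii : i = i'
  · subst hii
    by_cases hvv : v = v'
    · subst hvv
      have hcc : c ≠ c' := fun h => hne (by rw [h])
      have h := ip_pvec_pvec_le_inter (supp_x6_sub i) (supp_x6_sub i) (pat6 i v) (pat6 i v)
        (by norm_num : (0 : ℤ) ≤ 3 * 3) (3 * sgn c) (3 * sgn c')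
      rw [Finset.inter_self, card_supp_x6] at h
      have hs : sgn c * sgn c' = -1 := by
        revert hcc; cases c <;> cases c' <;> simp
      have e : (2 : ℤ) * (3 * sgn c) * (3 * sgn c') = 18 * (sgn c * sgn c') := by ring
      rw [e, hs] at h
      push_cast at h
      linarith
    · have hne' : ∃ j ∈ supp (x6 i), pat6 i v j ≠ pat6 i v' j := by
        by_contra hall
        push Not at hall
        exact hvv (pat6_inj hv hv' hall)
      have h := ip_pvec_pvec_le_of_odd_odd (supp_x6_sub i) (odd_card_pat6 i v) (odd_card_pat6 i v') hne'
        (by norm_num : (0 : ℤ) ≤ 3 * 3) (3 * sgn c) (3 * sgn c')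
      rw [card_supp_x6] at h
      revert h
      cases c <;> cases c' <;> simp <;> intro h <;> linarith
  · have h2 := card_x6_inter_x6 i.isLt i'.isLt (fun h => hii (Fin.ext h))
    have h := ip_pvec_pvec_le_inter (supp_x6_sub i) (supp_x6_sub i') (pat6 i v) (pat6 i' v')
      (by norm_num : (0 : ℤ) ≤ 3 * 3) (3 * sgn c) (3 * sgn c')
    have h2' : ((supp (x6 i) ∩ supp (x6 i')).card : ℤ) ≤ 2 := by exact_mod_cast h2
    revert h
    cases c <;> cases c' <;> simp <;> intro h <;> linarith

/-- `X · T ≤ 36` (only the axis contributes). -/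
theorem ip_XT {x y : Fin 24 → ℤ} (hx : x ∈ setX) (hy : y ∈ setT) : ip x y ≤ 36 := by
  obtain ⟨i, v, _, c, rfl⟩ := mem_setX.mp hx
  obtain ⟨c', rfl⟩ := mem_setT.mp hy
  have h := ip_pvec_pvec_le_inter (supp_x6_sub i) (Finset.empty_subset _) (pat6 i v) (fun _ => false)
    (by norm_num : (0 : ℤ) ≤ 3 * 0) (3 * sgn c) (6 * sgn c')
  rw [Finset.inter_empty, Finset.card_empty] at h
  revert h
  cases c <;> cases c' <;> simp <;> intro h <;> linarith

/-- **`X · D ≤ 36`**: parity on the cross plus the axis term `≤ 12`. -/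
theorem ip_XD {x y : Fin 24 → ℤ} (hx : x ∈ setX) (hy : y ∈ setD) : ip x y ≤ 36 := by
  obtain ⟨i, v, _, c, rfl⟩ := mem_setX.mp hx
  obtain ⟨p, hp, m, _, rfl⟩ := mem_setD.mp hy
  have hev : Even ((supp (x6 i)).filter fun j : Fin 24 => (cd p m).testBit j.val = true).card := by
    rw [card_filter_testBit]; exact even_card_x6_inter_cd i.isLt hp m
  have h := ip_pvec_pvec_le_of_odd_even (supp_x6_sub i) subset_rfl (odd_card_pat6 i v) hev
    (by norm_num : (0 : ℤ) ≤ 3 * 2) (3 * sgn c) (2 * sgn (decide (6 ≤ p)))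
  rw [card_supp_x6] at h
  revert h
  cases c <;> cases (decide (6 ≤ p)) <;> simp <;> intro h <;> linarith

/-- `T · T = -72 ≤ 36` for the two distinct axis vectors. -/
theorem ip_TT {x y : Fin 24 → ℤ} (hx : x ∈ setT) (hy : y ∈ setT) (hne : x ≠ y) : ip x y ≤ 36 := by
  obtain ⟨c, rfl⟩ := mem_setT.mp hx
  obtain ⟨c', rfl⟩ := mem_setT.mp hy
  have hcc : c ≠ c' := fun h => hne (by rw [h])
  have h := ip_pvec_pvec_le_inter (Finset.empty_subset cells) (Finset.empty_subset _) (fun _ => false)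
    (fun _ => false) (by norm_num : (0 : ℤ) ≤ 0 * 0) (6 * sgn c) (6 * sgn c')
  rw [Finset.inter_self, Finset.card_empty] at h
  revert h hcc
  cases c <;> cases c' <;> simp <;> intro h <;> linarith

/-- `T · D ≤ 24 ≤ 36`. -/
theorem ip_TD {x y : Fin 24 → ℤ} (hx : x ∈ setT) (hy : y ∈ setD) : ip x y ≤ 36 := by
  obtain ⟨c, rfl⟩ := mem_setT.mp hx
  obtain ⟨p, _, m, _, rfl⟩ := mem_setD.mp hy
  have h := ip_pvec_pvec_le_inter (Finset.empty_subset cells) subset_rfl (fun _ => false)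
    (fun j => (cd p m).testBit j.val) (by norm_num : (0 : ℤ) ≤ 0 * 2) (6 * sgn c) (2 * sgn (decide (6 ≤ p)))
  rw [Finset.empty_inter, Finset.card_empty] at h
  revert h
  cases c <;> cases (decide (6 ≤ p)) <;> simp <;> intro h <;> linarith

/-- **`D · D ≤ 36`** (in fact `≤ 24`): distinct words of the same half are at distance `≥ 6`; words of different
halves are at distance `≥ 4` and their axis signs are opposite. -/
theorem ip_DD {x y : Fin 24 → ℤ} (hx : x ∈ setD) (hy : y ∈ setD) (hne : x ≠ y) : ip x y ≤ 36 := by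
  obtain ⟨p, hp, m, hm, rfl⟩ := mem_setD.mp hx
  obtain ⟨p', hp', m', hm', rfl⟩ := mem_setD.mp hy
  have hne' : ¬ (p = p' ∧ m = m') := fun ⟨h1, h2⟩ => hne (by rw [h1, h2])
  obtain ⟨h6, h4⟩ := wtK_cd_xor hp hp' hm hm' hne'
  rw [ip_pvec_cells]
  by_cases hq : 6 ≤ p <;> by_cases hq' : 6 ≤ p'
  · have h := h6 (by omega)
    simp only [hq, hq', decide_true, sgn_true]; push_cast; omega
  · simp only [hq, hq', decide_true, decide_false, sgn_true, sgn_false]; push_cast; omega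
  · simp only [hq, hq', decide_true, decide_false, sgn_true, sgn_false]; push_cast; omega
  · have h := h6 (by omega)
    simp only [hq, hq', decide_false, sgn_false]; push_cast; omega

/-- **All pairwise inner products of distinct vectors are `≤ 36`** (half the norm). -/
theorem ip_le_of_mem {x y : Fin 24 → ℤ} (hx : x ∈ cl17Int) (hy : y ∈ cl17Int) (hne : x ≠ y) : ip x y ≤ 36 := by
  have hB := (abs_apply_le_of_mem (x := y)).1
  have hX := (abs_apply_le_of_mem (x := y)).2.1
  have hT := (abs_apply_le_of_mem (x := y)).2.2.1
  have hD := (abs_apply_le_of_mem (x := y)).2.2.2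
  have hB' := (abs_apply_le_of_mem (x := x)).1
  have hX' := (abs_apply_le_of_mem (x := x)).2.1
  have hT' := (abs_apply_le_of_mem (x := x)).2.2.1
  have hD' := (abs_apply_le_of_mem (x := x)).2.2.2
  rcases mem_cl17Int hx with hx | hx | hx | hx | hx <;> rcases mem_cl17Int hy with hy | hy | hy | hy | hy
  · exact ip_AA hx hy hne
  · exact (ip_setA_le hx (hB hy)).trans (by norm_num)
  · exact (ip_setA_le hx (hX hy)).trans (by norm_num)
  · exact (ip_setA_le hx (hT hy)).trans (by norm_num)
  · exact (ip_setA_le hx (hD hy)).trans (by norm_num)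
  · rw [ip_comm]; exact (ip_setA_le hy (hB' hx)).trans (by norm_num)
  · exact ip_BB hx hy hne
  · exact ip_BX hx hy
  · exact ip_BT hx hy
  · exact ip_BD hx hy
  · rw [ip_comm]; exact (ip_setA_le hy (hX' hx)).trans (by norm_num)
  · rw [ip_comm]; exact ip_BX hy hx
  · exact ip_XX hx hy hne
  · exact ip_XT hx hy
  · exact ip_XD hx hy
  · rw [ip_comm]; exact (ip_setA_le hy (hT' hx)).trans (by norm_num)
  · rw [ip_comm]; exact ip_BT hy hx
  · rw [ip_comm]; exact ip_XT hy hx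
  · exact ip_TT hx hy hne
  · exact ip_TD hx hy
  · rw [ip_comm]; exact (ip_setA_le hy (hD' hx)).trans (by norm_num)
  · rw [ip_comm]; exact ip_BD hy hx
  · rw [ip_comm]; exact ip_XD hy hx
  · rw [ip_comm]; exact ip_TD hy hx
  · exact ip_DD hx hy hne

end Summit.Ventures.PackingBounds.Config.CL17
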